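import Summits.SmoothPoincare4.SmoothPoincare4.Statement
import Summits.SmoothPoincare4.SmoothPoincare4.Theorems.SoloBlindFreeS3Actions
import Literature.Topology.FourManifolds.FreeS3ActionsSevenSphere
import Literature.Topology.FourManifolds.HopfGreatSphereOrbits
import Literature.Geometry.Riemannian.GreatSphereFibrationsHahl
import Literature.Geometry.Riemannian.GreatSphereFibrationBaseSphereHahl
import HarnessLib
import HarnessLib.Audit

/-!
# SPC4 as a straightening problem for free `S³`-actions on `S⁷` (solo-SmoothPoincare4-blind, s2)

Write-up: `run/shared/lean/ideation/SmoothPoincare4/solo-blind/paper/great-sphere-fibrations.md`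
(Theorems G and H there).

RECOGNITION for linear fibres is a theorem: the base of a smooth fibration of `S⁷` by great
3-spheres is diffeomorphic to `S⁴` — Hähl 1987, Thm. 1.3 / §4.8 (tree: the corrected named fact
`Literature.Geometry.Riemannian.Hahl1987_greatSphereFibration_base_sphere'`; the write-up contains an
independent elementary proof: open great hemisphere ≅ base minus a point, a graph-chart expansion at
the missing fibre shows the complementary piece is a star-shaped ball, Cerf's `Γ₄ = 0`).

EXISTENCE is the open half, recorded as the `@[conjecture]` obligation node
`FreeS3ActionsS7Straighten`: every free smooth `S³`-action on the standard `S⁷` is conjugate in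
`Diff(S⁷)` to one admitting an orbit map that is a smooth great-3-sphere fibration. Kernel-checked
below (sorry-free, standard axioms): `STRAIGHTEN ⇒ SPC4` and `SPC4 ⇒ STRAIGHTEN`, hence the `iff`,
modulo exactly: Theorem A of session 1 (`HomotopySphereFourIsOrbitSpace`, the seat's claim), the
textbook facts of `Literature.Topology.FourManifolds` (orbit spaces, descent of conjugacies,
classification of principal `SU(2)`-bundles over `S⁴`, the Hopf action with great orbits) and Hähl's
theorem. So the whole difficulty of SPC4 is the straightening of the orbits of a free `S³`-action on
`S⁷` to great 3-spheres by an ambient diffeomorphism.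
-/

noncomputable section

open scoped Manifold ContDiff

namespace Summit.SmoothPoincare4.SmoothPoincare4.Theorems

open Literature.Topology.FourManifolds Literature.Geometry.Riemannian

/-- **STRAIGHTEN — the existence half of SPC4 in the language of free `S³`-actions (OPEN; equivalent
to SPC4 by `smoothPoincare4_iff_straighten`).** Every free smooth `S³`-action `a` on `S⁷` is
conjugate, by a diffeomorphism of `S⁷`, to an action `b` which admits an orbit map
`π : S⁷ → N` onto some Hausdorff second-countable smooth 4-manifold that is a smooth fibration by
great 3-spheres (`IsSmoothGreatSphereFibration π`: all `b`-orbits are great 3-spheres `S⁷ ∩ V`). -/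
@[conjecture] def FreeS3ActionsS7Straighten : Prop :=
  ∀ a : FreeS3ActionS7, ∃ b : FreeS3ActionS7, a.IsConj b ∧
    ∃ (N : Type) (_ : TopologicalSpace N) (_ : T2Space N) (_ : SecondCountableTopology N)
      (_ : ChartedSpace (EuclideanSpace ℝ (Fin 4)) N) (_ : IsManifold (𝓡 4) ∞ N)
      (π : Metric.sphere (0 : EuclideanSpace ℝ (Fin (7 + 1))) 1 → N),
      b.IsOrbitMap N π ∧ IsSmoothGreatSphereFibration π

/-- **STRAIGHTEN ⇒ SPC4** (write-up Thm. H, (iii) ⇒ (i)), modulo Theorem A (every smooth homotopy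
4-sphere is an orbit space), descent of conjugacies to orbit spaces, and Hähl's theorem (base of a
great-3-sphere fibration of `S⁷` is `S⁴`). Given `M`, realise it as `S⁷/a`; straighten `a` to `b`
with great-sphere orbit map `π : S⁷ → N`; then `M ≅ N` (descent) and `N ≅ S⁴` (Hähl). -/
theorem smoothPoincare4_of_straighten
    (hA : HomotopySphereFourIsOrbitSpace) (hD : OrbitSpaceDiffeomorphOfIsConj)
    (hG : Hahl1987_greatSphereFibration_base_sphere')
    (hS : FreeS3ActionsS7Straighten) : SmoothPoincare4 := by
  unfold SmoothPoincare4 Literature.SPC4.SmoothPoincareConjectureFour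
  intro M _ _ _
  unfold ContinuousMap.HomotopyEquiv.NonemptyDiffeomorphSphere
  intro cs im he
  obtain ⟨a, π, hπ⟩ := hA M he
  obtain ⟨b, hab, N, _, _, _, _, _, πb, hπb, hfib⟩ := hS a
  obtain ⟨φ⟩ := hD a b M N π πb hπ hπb hab
  obtain ⟨ψ⟩ := hG N πb hfib
  exact ⟨φ.trans ψ⟩

/-- **SPC4 ⇒ STRAIGHTEN** (write-up Thm. H, (i) ⇒ (iii)), modulo existence and homotopy type of
orbit spaces, the classification of principal `SU(2)`-bundles over `S⁴` with total space `S⁷`, and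
the Hopf action with great-sphere orbits: the orbit space of `a` is a smooth homotopy 4-sphere, hence
`S⁴` under SPC4, hence `a` is conjugate to the Hopf action, whose Hopf map is a great-3-sphere
fibration onto `S⁴`. -/
theorem straighten_of_smoothPoincare4
    (hE : ExistsOrbitSpaceOfFreeS3ActionS7) (hC : IsConjOfOrbitSpacesSphere)
    (hH : ExistsHopfActionS7GreatOrbits) (h4 : SmoothPoincare4) : FreeS3ActionsS7Straighten := by
  intro a
  obtain ⟨b, πb, hπb, hfib⟩ := hH
  obtain ⟨M, _, _, _, _, _, πa, hπa, ⟨eM⟩⟩ := hE a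
  have hM : Nonempty (M ≃ₘ⟮𝓡 4, 𝓡 4⟯ Metric.sphere (0 : EuclideanSpace ℝ (Fin (4 + 1))) 1) := by
    have h := h4 M
    unfold ContinuousMap.HomotopyEquiv.NonemptyDiffeomorphSphere at h
    exact h _ ‹_› eM
  have hab : a.IsConj b := hC a b M _ πa πb hπa hπb hM ⟨Diffeomorph.refl _ _ _⟩
  exact ⟨b, hab, Metric.sphere (0 : EuclideanSpace ℝ (Fin (4 + 1))) 1, inferInstance, inferInstance,
    inferInstance, inferInstance, inferInstance, πb, hπb, hfib⟩

/-- **SPC4 ⇔ STRAIGHTEN** (write-up, Theorem H (i) ⇔ (iii)); trust base = exactly the listed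
hypotheses: four textbook facts of `Literature.Topology.FourManifolds`, Hähl 1987 (Literature), and
the seat's Theorem A (`HomotopySphereFourIsOrbitSpace`, `@[conjecture]` node of session 1). -/
theorem smoothPoincare4_iff_straighten
    (hA : HomotopySphereFourIsOrbitSpace) (hE : ExistsOrbitSpaceOfFreeS3ActionS7)
    (hD : OrbitSpaceDiffeomorphOfIsConj) (hC : IsConjOfOrbitSpacesSphere)
    (hH : ExistsHopfActionS7GreatOrbits) (hG : Hahl1987_greatSphereFibration_base_sphere') :
    SmoothPoincare4 ↔ FreeS3ActionsS7Straighten :=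
  ⟨straighten_of_smoothPoincare4 hE hC hH, smoothPoincare4_of_straighten hA hD hG⟩

end Summit.SmoothPoincare4.SmoothPoincare4.Theorems
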